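import Mathlib
import Literature.Dynamics.Contraction.ComplexConeContractionThm36Proofs
import Summits.CriticalPhenomena.CardyFormulaZ2.Theses.CardyComplexCone

/-!
# Inner-indexed block chains: cone preservation and the re-indexed contraction bound

Helper file for item stmt-CriticalPhenomena-8880 (`MarkovBlockPresentation`, route CardyComplexCone of
`CriticalPhenomena/CardyFormulaZ2`), part (ii) "CONTRACTION ⇒ COHERENCE". The route's engine
`Summit.CriticalPhenomena.CardyFormulaZ2.Theses.CardyComplexCone.ComplexConeContraction` (item
stmt-CriticalPhenomena-8789, Dubois 2009 Thm 2.3 + Thm 3.6) is stated for trajectories `x (j+1) = A j x j`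
indexed from their START. In a Markov block presentation the block kernels are shared between different
outer data (domains, points, meshes) when the annulus blocks are indexed from the INSIDE: pattern spaces
`Fin (n k)`, `k = 0` the innermost one (where the corner test functions live), blocks
`B k : Fin (n k) × Fin (n (k+1)) → ℂ` propagating level `k+1` to level `k`, and a depth-`K` trajectory is
`v : (k : ℕ) → Fin (n k) → ℂ` with `v k = B k *ᵥ v (k+1)` for `k < K`, outer datum `v K ∈ ℂ₊ ∖ {0}`.

Contents:
* `mulVec_mem_rughConeInt_rect` — RECTANGULAR reading of Dubois 2009, Prop. 3.3 (⇐): a complex `m × n`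
  matrix satisfying (3.20) maps `ℂⁿ₊ ∖ {0}` into `Int ℂᵐ₊` (reduced to the square case
  `Literature.Dynamics.Contraction.mulVec_mem_rughConeInt` by padding with repeated rows / columns);
* `traj_mem_rughConeInt`, `traj_ne_zero`, `traj_mem_rughCone`, `exists_traj` — trajectories of a block
  chain satisfying Dubois' condition stay in `Int ℂ₊`, and every outer datum has a trajectory;
* `inner_bound` — the engine's two-trajectory cross-ratio bound, RE-INDEXED from the inside:
  `ComplexConeContraction` gives `C ≥ 0`, `r ∈ [0,1)` with
  `‖⟨f,v 0⟩⟨g,w 0⟩ / (⟨f,w 0⟩⟨g,v 0⟩) − 1‖ ≤ C r^K` for any two depth-`K` trajectories `v, w` and test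
  vectors `f, g ∈ ℂ₊ ∖ {0}` at level `0` (the engine is applied to the reversed chain, padded beyond depth
  `K` by all-ones matrices, which satisfy Dubois' condition).

Reference: L. Dubois, *Projective metrics and contraction principles for complex cones*, J. London
Math. Soc. 79 (2009), Prop. 3.3, Thm 3.6 (arXiv:0811.2930).
-/

namespace Summit.CriticalPhenomena.CardyFormulaZ2.Theorems.MarkovBlockPresentation

open scoped ComplexConjugate
open Matrix Literature.Dynamics.Contraction
open Summit.CriticalPhenomena.CardyFormulaZ2.Theses.CardyComplexCone (ComplexConeContraction)

/-! ### Index bookkeeping -/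

/-- Extending a sum over `Fin n` by zero to `Fin N`, `n ≤ N`. -/
theorem sum_fin_extend {N n : ℕ} (hnN : n ≤ N) (G : Fin n → ℂ) :
    ∑ b : Fin N, (if h : (b : ℕ) < n then G ⟨b, h⟩ else 0) = ∑ p : Fin n, G p := by
  set g : ℕ → ℂ := fun j => if h : j < n then G ⟨j, h⟩ else 0 with hg
  have h1 : ∑ b : Fin N, (if h : (b : ℕ) < n then G ⟨b, h⟩ else 0) = ∑ j ∈ Finset.range N, g j :=
    Fin.sum_univ_eq_sum_range g N
  have h2 : ∑ p : Fin n, G p = ∑ j ∈ Finset.range n, g j := by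
    rw [← Fin.sum_univ_eq_sum_range g n]
    exact Finset.sum_congr rfl fun p _ => by simp [hg]
  rw [h1, h2]
  symm
  apply Finset.sum_subset (Finset.range_subset_range.2 hnN)
  intro j _ hj
  rw [Finset.mem_range, not_lt] at hj
  simp [hg, not_lt.2 hj]

/-- Transport of a pairing `∑ F b · v i b` along an equality of levels `i = i'`. -/
theorem sum_mul_cast {n : ℕ → ℕ} (v : (k : ℕ) → Fin (n k) → ℂ) {i i' : ℕ} (e : i = i')
    (F : Fin (n i') → ℂ) :
    ∑ b : Fin (n i), F (Fin.cast (congrArg n e) b) * v i b = ∑ b : Fin (n i'), F b * v i' b := by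
  subst e; rfl

/-- Transport of `∑ v i b` along an equality of levels `i = i'`. -/
theorem sum_cast {n : ℕ → ℕ} (v : (k : ℕ) → Fin (n k) → ℂ) {i i' : ℕ} (e : i = i') :
    ∑ b : Fin (n i), v i b = ∑ b : Fin (n i'), v i' b := by
  subst e; rfl

/-! ### Rectangular cone preservation (Dubois 2009, Prop. 3.3, rectangular reading) -/

/-- **Dubois 2009, Prop. 3.3 (⇐), rectangular matrices.** A complex `m × n` matrix (`m, n ≥ 1`) with
`|a_kp a_lq − a_kq a_lp| < Re(conj(a_kp) a_lq + conj(a_kq) a_lp)` for all rows `k, l` and columns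
`p, q` maps `ℂⁿ₊ ∖ {0}` into `Int ℂᵐ₊`. Proof: pad `A` to the square matrix `A' = A ∘ (σ × τ)` of size
`m + n` by repeating rows and columns (`σ i = i mod m`, `τ b = b mod n`), which satisfies the same
condition, and apply the square case to `x'` = `x` extended by zeros: `A' x' = (A x) ∘ σ`. -/
theorem mulVec_mem_rughConeInt_rect {m n : ℕ} (hm : 0 < m) (hn : 0 < n)
    {A : Matrix (Fin m) (Fin n) ℂ}
    (h320 : ∀ k l p q, ‖A k p * A l q - A k q * A l p‖ <
      (conj (A k p) * A l q + conj (A k q) * A l p).re)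
    {x : Fin n → ℂ} (hx : x ∈ rughCone n) (hx0 : x ≠ 0) : A *ᵥ x ∈ rughConeInt m := by
  let σ : Fin (m + n) → Fin m := fun i => ⟨(i : ℕ) % m, Nat.mod_lt _ hm⟩
  let τ : Fin (m + n) → Fin n := fun i => ⟨(i : ℕ) % n, Nat.mod_lt _ hn⟩
  let A' : Matrix (Fin (m + n)) (Fin (m + n)) ℂ := A.submatrix σ τ
  let x' : Fin (m + n) → ℂ := fun b => if h : (b : ℕ) < n then x ⟨b, h⟩ else 0
  have h320' : ∀ k l p q, ‖A' k p * A' l q - A' k q * A' l p‖ <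
      (conj (A' k p) * A' l q + conj (A' k q) * A' l p).re :=
    fun k l p q => h320 (σ k) (σ l) (τ p) (τ q)
  have hx' : x' ∈ rughCone (m + n) := by
    intro a b
    simp only [x']
    split_ifs with ha hb hb
    · exact hx _ _
    · simp
    · simp
    · simp
  have hx'0 : x' ≠ 0 := by
    obtain ⟨p, hp⟩ := Function.ne_iff.1 hx0
    intro h
    have h' := congrFun h ⟨p, by omega⟩
    simp only [x', Fin.is_lt, ↓reduceDIte, Fin.eta, Pi.zero_apply] at h'
    exact hp h'
  have hmv : ∀ i, (A' *ᵥ x') i = (A *ᵥ x) (σ i) := by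
    intro i
    simp only [Matrix.mulVec, dotProduct, A', Matrix.submatrix_apply, x']
    have h1 : ∀ b : Fin (m + n), A (σ i) (τ b) * (if h : (b : ℕ) < n then x ⟨b, h⟩ else 0) =
        (if h : (b : ℕ) < n then A (σ i) ⟨b, h⟩ * x ⟨b, h⟩ else 0) := by
      intro b
      split_ifs with h
      · have : τ b = ⟨b, h⟩ := Fin.ext (Nat.mod_eq_of_lt h)
        rw [this]
      · rw [mul_zero]
    rw [Finset.sum_congr rfl fun b _ => h1 b]
    exact sum_fin_extend (Nat.le_add_left n m) (fun p => A (σ i) p * x p)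
  have hInt := mulVec_mem_rughConeInt h320' hx' hx'0
  intro k l
  have h := hInt ⟨k, by omega⟩ ⟨l, by omega⟩
  rw [hmv, hmv] at h
  have hk : σ ⟨k, by omega⟩ = k := Fin.ext (Nat.mod_eq_of_lt k.isLt)
  have hl : σ ⟨l, by omega⟩ = l := Fin.ext (Nat.mod_eq_of_lt l.isLt)
  rwa [hk, hl] at h

/-! ### Block chains satisfying Dubois' condition -/

section Chain

variable {θ σ : ℝ} {n : ℕ → ℕ} {B : (k : ℕ) → Matrix (Fin (n k)) (Fin (n (k + 1))) ℂ}

/-- Dubois' `θ`-condition (engine form, `0 < θ < 1`) implies the strict condition (3.20) for every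
block. -/
theorem block_strict (hθ0 : 0 < θ) (hθ1 : θ < 1)
    (hB : ∀ k a b p q, θ⁻¹ * ‖B k a p * B k b q - B k a q * B k b p‖ <
        (star (B k a p) * B k b q + star (B k a q) * B k b p).re ∧
      ‖B k a p * B k b q‖ ≤ σ ^ 2 * ‖B k a q * B k b p‖) (k : ℕ) :
    ∀ a b p q, ‖B k a p * B k b q - B k a q * B k b p‖ <
      (conj (B k a p) * B k b q + conj (B k a q) * B k b p).re := by
  intro a b p q
  have h := (hB k a b p q).1
  simp only [starRingEnd_apply]
  refine lt_of_le_of_lt ?_ h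
  have h1 : 1 ≤ θ⁻¹ := (one_le_inv₀ hθ0).2 hθ1.le
  have h2 := norm_nonneg (B k a p * B k b q - B k a q * B k b p)
  nlinarith

/-- Along a depth-`K` trajectory of a block chain satisfying Dubois' condition, started at an outer
datum `v K ∈ ℂ₊ ∖ {0}`, every vector is in `ℂ₊` and nonzero (downward induction with
`mulVec_mem_rughConeInt_rect`). -/
theorem traj_mem_rughCone (hθ0 : 0 < θ) (hθ1 : θ < 1) (hn : ∀ k, 0 < n k)
    (hB : ∀ k a b p q, θ⁻¹ * ‖B k a p * B k b q - B k a q * B k b p‖ <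
        (star (B k a p) * B k b q + star (B k a q) * B k b p).re ∧
      ‖B k a p * B k b q‖ ≤ σ ^ 2 * ‖B k a q * B k b p‖)
    {K : ℕ} {v : (k : ℕ) → Fin (n k) → ℂ} (hv : ∀ k < K, v k = B k *ᵥ v (k + 1))
    (hvc : v K ∈ rughCone (n K)) (hv0 : v K ≠ 0) :
    ∀ k ≤ K, v k ∈ rughCone (n k) ∧ v k ≠ 0 := by
  suffices h : ∀ d k, k + d = K → v k ∈ rughCone (n k) ∧ v k ≠ 0 from
    fun k hk => h (K - k) k (by omega)
  intro d
  induction d with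
  | zero =>
    intro k hk
    rw [add_zero] at hk
    subst hk
    exact ⟨hvc, hv0⟩
  | succ d ih =>
    intro k hk
    obtain ⟨hc, h0⟩ := ih (k + 1) (by omega)
    have hInt : v k ∈ rughConeInt (n k) := by
      rw [hv k (by omega)]
      exact mulVec_mem_rughConeInt_rect (hn k) (hn (k + 1)) (block_strict hθ0 hθ1 hB k) hc h0
    refine ⟨rughConeInt_subset _ hInt, fun h => ?_⟩
    have h' := ne_zero_of_mem_rughConeInt hInt ⟨0, hn k⟩
    rw [h] at h'
    exact h' rfl

/-- Along such a trajectory every vector strictly below the outer level lies in `Int ℂ₊`. -/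
theorem traj_mem_rughConeInt (hθ0 : 0 < θ) (hθ1 : θ < 1) (hn : ∀ k, 0 < n k)
    (hB : ∀ k a b p q, θ⁻¹ * ‖B k a p * B k b q - B k a q * B k b p‖ <
        (star (B k a p) * B k b q + star (B k a q) * B k b p).re ∧
      ‖B k a p * B k b q‖ ≤ σ ^ 2 * ‖B k a q * B k b p‖)
    {K : ℕ} {v : (k : ℕ) → Fin (n k) → ℂ} (hv : ∀ k < K, v k = B k *ᵥ v (k + 1))
    (hvc : v K ∈ rughCone (n K)) (hv0 : v K ≠ 0) :
    ∀ k < K, v k ∈ rughConeInt (n k) := by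
  intro k hk
  obtain ⟨hc, h0⟩ := traj_mem_rughCone hθ0 hθ1 hn hB hv hvc hv0 (k + 1) hk
  rw [hv k hk]
  exact mulVec_mem_rughConeInt_rect (hn k) (hn (k + 1)) (block_strict hθ0 hθ1 hB k) hc h0

omit θ σ in
/-- Every outer datum `a` at level `K` has a depth-`K` trajectory. -/
theorem exists_traj (B : (k : ℕ) → Matrix (Fin (n k)) (Fin (n (k + 1))) ℂ) :
    ∀ (K : ℕ) (a : Fin (n K) → ℂ), ∃ v : (k : ℕ) → Fin (n k) → ℂ,
      v K = a ∧ ∀ k < K, v k = B k *ᵥ v (k + 1) := by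
  intro K
  induction K with
  | zero =>
    intro a
    refine ⟨fun k => if h : k = 0 then fun i => a (Fin.cast (congrArg n h) i) else 0, ?_,
      fun k hk => absurd hk (Nat.not_lt_zero k)⟩
    funext i
    show (if h : (0 : ℕ) = 0 then fun i => a (Fin.cast (congrArg n h) i) else 0) i = a i
    rw [dif_pos rfl]
    exact congrArg a (Fin.ext rfl)
  | succ K ih =>
    intro a
    obtain ⟨v, hvK, hv⟩ := ih (B K *ᵥ a)
    refine ⟨fun k => if h : k = K + 1 then fun i => a (Fin.cast (congrArg n h) i) else v k, ?_, ?_⟩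
    · funext i
      show (if h : K + 1 = K + 1 then fun i => a (Fin.cast (congrArg n h) i) else v (K + 1)) i = a i
      rw [dif_pos rfl]
      exact congrArg a (Fin.ext rfl)
    · intro k hk
      have hk1 : k ≠ K + 1 := by omega
      show (if h : k = K + 1 then fun i => a (Fin.cast (congrArg n h) i) else v k) =
        B k *ᵥ (if h : k + 1 = K + 1 then fun i => a (Fin.cast (congrArg n h) i) else v (k + 1))
      rw [dif_neg hk1]
      by_cases hkK : k = K
      · subst hkK
        rw [dif_pos rfl, hvK]
        rfl
      · have hk2 : k + 1 ≠ K + 1 := by omega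
        rw [dif_neg hk2]
        exact hv k (by omega)

/-- **The engine re-indexed from the inside.** `ComplexConeContraction` (Dubois' contraction principle in
the route's sequential reading) gives constants `C ≥ 0`, `r ∈ [0,1)` depending on `(θ, σ)` only, such that
for every depth `K ≥ 1`, any two depth-`K` trajectories `v, w` of the block chain started at outer data in
`ℂ₊ ∖ {0}`, and any two test vectors `f, g ∈ ℂ₊ ∖ {0}` at the innermost level, the cross-ratio of the four
read-outs is within `C r^K` of `1`:
`‖⟨f,v 0⟩⟨g,w 0⟩ / (⟨f,w 0⟩⟨g,v 0⟩) − 1‖ ≤ C r^K`. -/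
theorem inner_bound (hCCC : ComplexConeContraction) (hθ0 : 0 < θ) (hθ1 : θ < 1) (hσ : 1 ≤ σ)
    (hn : ∀ k, 0 < n k)
    (hB : ∀ k a b p q, θ⁻¹ * ‖B k a p * B k b q - B k a q * B k b p‖ <
        (star (B k a p) * B k b q + star (B k a q) * B k b p).re ∧
      ‖B k a p * B k b q‖ ≤ σ ^ 2 * ‖B k a q * B k b p‖) :
    ∃ C r : ℝ, 0 ≤ C ∧ 0 ≤ r ∧ r < 1 ∧ ∀ K, 1 ≤ K → ∀ v w : (k : ℕ) → Fin (n k) → ℂ,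
      (∀ k < K, v k = B k *ᵥ v (k + 1)) → (∀ k < K, w k = B k *ᵥ w (k + 1)) →
      v K ∈ rughCone (n K) → v K ≠ 0 → w K ∈ rughCone (n K) → w K ≠ 0 →
      ∀ f g : Fin (n 0) → ℂ, f ∈ rughCone (n 0) → f ≠ 0 → g ∈ rughCone (n 0) → g ≠ 0 →
      ‖(∑ i, f i * v 0 i) * (∑ i, g i * w 0 i) / ((∑ i, f i * w 0 i) * (∑ i, g i * v 0 i)) - 1‖
        ≤ C * r ^ K := by
  obtain ⟨C, r, hC, hr0, hr1, hmain⟩ := hCCC θ σ hθ0 hθ1 hσ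
  refine ⟨C, r, hC, hr0, hr1, fun K hK v w hv hw hvc hv0 hwc hw0 f g hfc hf0 hgc hg0 => ?_⟩
  -- the reversed chain, padded by all-ones matrices beyond depth `K`
  have hcast : ∀ j, j < K → K - j = K - (j + 1) + 1 := fun j hj => by omega
  let A : (j : ℕ) → Matrix (Fin (n (K - (j + 1)))) (Fin (n (K - j))) ℂ := fun j =>
    Matrix.of fun a b =>
      if hj : j < K then B (K - (j + 1)) a (Fin.cast (congrArg n (hcast j hj)) b) else 1
  -- reversed trajectories, padded consistently
  let ext : ((k : ℕ) → Fin (n k) → ℂ) → (j : ℕ) → Fin (n (K - j)) → ℂ := fun u j =>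
    if j ≤ K then u (K - j) else fun _ => (n 0 : ℂ) ^ (j - K - 1) * ∑ i, u 0 i
  have hA : ∀ j k l p q, θ⁻¹ * ‖A j k p * A j l q - A j k q * A j l p‖ <
      (star (A j k p) * A j l q + star (A j k q) * A j l p).re ∧
      ‖A j k p * A j l q‖ ≤ σ ^ 2 * ‖A j k q * A j l p‖ := by
    intro j k l p q
    by_cases hj : j < K
    · simp only [A, Matrix.of_apply, dif_pos hj]
      exact hB _ _ _ _ _
    · simp only [A, Matrix.of_apply, dif_neg hj, mul_one, sub_self, norm_zero, mul_zero, star_one,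
        Complex.add_re, Complex.one_re, norm_one]
      constructor
      · norm_num
      · nlinarith
  have hext0 : ∀ u : (k : ℕ) → Fin (n k) → ℂ, ext u 0 = u K := fun u => if_pos (Nat.zero_le K)
  have hextK : ∀ u : (k : ℕ) → Fin (n k) → ℂ, ext u K = u (K - K) := fun u => if_pos le_rfl
  have htraj : ∀ u : (k : ℕ) → Fin (n k) → ℂ, (∀ k < K, u k = B k *ᵥ u (k + 1)) →
      ∀ j, ext u (j + 1) = A j *ᵥ ext u j := by
    intro u hu j
    rcases Nat.lt_trichotomy j K with hj | hj | hj
    · have h1 : ext u (j + 1) = u (K - (j + 1)) := if_pos (by omega)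
      have h2 : ext u j = u (K - j) := if_pos hj.le
      rw [h1, h2, hu (K - (j + 1)) (by omega)]
      funext a
      simp only [Matrix.mulVec, dotProduct, A, Matrix.of_apply, dif_pos hj]
      exact (sum_mul_cast u (hcast j hj) (fun b => B (K - (j + 1)) a b)).symm
    · subst hj
      have h1 : ext u (j + 1) = fun _ => (n 0 : ℂ) ^ (j + 1 - j - 1) * ∑ i, u 0 i :=
        if_neg (by omega)
      rw [h1, hextK u]
      funext a
      simp only [Matrix.mulVec, dotProduct, A, Matrix.of_apply, dif_neg (lt_irrefl j), one_mul]
      rw [sum_cast u (Nat.sub_self j), show j + 1 - j - 1 = 0 by omega, pow_zero, one_mul]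
    · have h1 : ext u (j + 1) = fun _ => (n 0 : ℂ) ^ (j + 1 - K - 1) * ∑ i, u 0 i :=
        if_neg (by omega)
      have h2 : ext u j = fun _ => (n 0 : ℂ) ^ (j - K - 1) * ∑ i, u 0 i := if_neg (by omega)
      rw [h1, h2]
      funext a
      simp only [Matrix.mulVec, dotProduct, A, Matrix.of_apply, dif_neg (show ¬ j < K by omega),
        one_mul, Finset.sum_const, Finset.card_univ, Fintype.card_fin, nsmul_eq_mul]
      rw [Nat.sub_eq_zero_of_le hj.le, show j + 1 - K - 1 = (j - K - 1) + 1 by omega, pow_succ]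
      ring
  have hstar : ∀ {m : ℕ} (u : Fin m → ℂ), u ∈ rughCone m → ∀ k l, 0 ≤ (u k * star (u l)).re :=
    fun u hu k l => by simpa only [starRingEnd_apply] using hu k l
  -- test vectors transported to level `K - K`
  have e0 : n (K - K) = n 0 := congrArg n (Nat.sub_self K)
  let f' : Fin (n (K - K)) → ℂ := fun i => f (Fin.cast e0 i)
  let g' : Fin (n (K - K)) → ℂ := fun i => g (Fin.cast e0 i)
  have hne : ∀ u : Fin (n 0) → ℂ, u ≠ 0 → (fun i : Fin (n (K - K)) => u (Fin.cast e0 i)) ≠ 0 := by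
    intro u hu h
    apply hu
    funext p
    have h' := congrFun h (Fin.cast e0.symm p)
    have hp : Fin.cast e0 (Fin.cast e0.symm p) = p := Fin.ext rfl
    rw [hp] at h'
    exact h'
  have hcone : ∀ u : Fin (n 0) → ℂ, u ∈ rughCone (n 0) →
      ∀ k l, 0 ≤ ((fun i : Fin (n (K - K)) => u (Fin.cast e0 i)) k *
        star ((fun i : Fin (n (K - K)) => u (Fin.cast e0 i)) l)).re :=
    fun u hu k l => hstar u hu _ _
  have key := hmain (fun j => n (K - j)) A (fun j => hn _) hA (ext v) (ext w) (htraj v hv) (htraj w hw)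
    (by rw [hext0]; exact hv0) (by rw [hext0]; exact hw0)
    (by rw [hext0]; exact hstar _ hvc) (by rw [hext0]; exact hstar _ hwc)
    K hK f' g' (hne f hf0) (hne g hg0) (hcone f hfc) (hcone g hgc)
  have conv : ∀ (u : (k : ℕ) → Fin (n k) → ℂ) (t : Fin (n 0) → ℂ),
      ∑ k, (fun i : Fin (n (K - K)) => t (Fin.cast e0 i)) k * ext u K k = ∑ i, t i * u 0 i := by
    intro u t
    rw [hextK u]
    exact sum_mul_cast u (Nat.sub_self K) t
  simp only [f', g'] at key
  rw [conv v f, conv w g, conv w f, conv v g] at key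
  exact key

end Chain

end Summit.CriticalPhenomena.CardyFormulaZ2.Theorems.MarkovBlockPresentation
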